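import Literature.AlgebraicGeometry.AbelianSchemes.TupleIsoAtOfFibreIso
import Literature.AlgebraicGeometry.AbelianSchemes.AbelianSchemeDualTransportUnique
import Literature.AlgebraicGeometry.AbelianSchemes.AbelianSchemeOverZariskiGluingHom
import Literature.AlgebraicGeometry.AbelianSchemes.PolarizedAbelianSchemeWithLevelGenericFibreExtension
import Literature.AlgebraicGeometry.AbelianSchemes.AbelianSchemeDualTransportOfBaseChange
import Literature.AlgebraicGeometry.Morphisms.HomSchemeYoneda
import HarnessLib

/-!
# Point criteria for isomorphisms of MFK tuples: the converse of «TUPLE-ISO OF FIBRE ISO» and its two-tuple form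

Topic `AlgebraicGeometry/AbelianSchemes`; namespace `Literature.AlgebraicGeometry.AbelianSchemes.AbelianSchemeOver`.
THEOREMS ONLY (no def, no instance, no notation, no named fact, no `sorry`).  Cell hodgecm-mathlib (D-0151), P6 «MOD programme»,
SPREAD door, SP3-a2 line `Lines/F0_P6a_IsomSchemeFiniteType.lean` (A-p14 (g34)), organ (T2) for `stub_ICON` (A-p13 (g37),
2026-09-01): the stub's iff is read at geometric points `Spec Ω`, where an «isomorphism of tuples via `(G, Ĝ)`» (the five
clauses of [MumfordFogartyKirwan1994] Def. 7.2–7.3 along `𝟙 T`: level ∕ `X`, `X̂`, Poincaré, `λ`, `𝒪`-action — the line's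
`TupleIsoVia`) must be traded for an isomorphism of group schemes EXACT on `λ` in dual-homomorphism form, on the level sections
and on the action — the input of ★ Layer A `isoOfTriples_id_of_iso` — and back.  HC_CM is proved only modulo the printed
citations until rung 0 closes; nothing here is about HC.

* §1 **`exists_iso_of_tupleRel_id`** — THE CONVERSE OF LAYER A: over a reduced locally Noetherian `T`, the five clauses along
  `𝟙 T` for `(G, Ĝ)` yield an isomorphism of `T`-group schemes `e : A₁ ≅ A₂` with `e.hom.left = G`, `Ĝ = Ĥ_e` (★ K3-a
  `eq_hatTransport_of_nonempty_pullback_map_iso`), `e ≫ λ₂ ≫ e^∨ = λ₁` (★ `hatTransportOver_comp_dualIsogenyOver_hom`),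
  `σ₁ᵢ ≫ e = σ₂ᵢ`, `ι₁(a) ≫ e = e ≫ ι₂(a)`; `isIso_of_isBaseChangeVia_id` (the `X`-clause along `𝟙` makes `G` invertible).
* §2 **`exists_tupleRel_baseChange_comp_of_iso₂`** — TWO-TUPLE «TUPLE-ISO OF FIBRE ISO»: for two tuples over `Y`, `π : Y₀ → Y`,
  `x : T → Y₀` (`T` reduced connected locally Noetherian), an isomorphism of the ITERATED pull-backs
  `((𝒜₁ ×_Y Y₀) ×_{Y₀} T) ≅ ((𝒜₂ ×_Y Y₀) ×_{Y₀} T)` exact on `λ` ∕ level ∕ action yields the five clauses between the SINGLE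
  pull-backs `𝒜ᵢ ×_{Y, x ≫ π} T` (★ `tupleRel_baseChangeCompGrpIso_hom` for `𝒜₁`, ★ Layer A, ★ `…_inv` for `𝒜₂`, composed by
  ★ `tupleRel_comp_id_id`) — ★ `exists_tupleRel_baseChange_comp_of_iso` is the case `𝒜₁ = 𝒜₂`.

## References
* [MumfordFogartyKirwan1994] D. Mumford, J. Fogarty, F. Kirwan, *Geometric Invariant Theory*, 3rd ed. (1994), Ch. 7 §2 Def. 7.2
  (p. 129), Def. 7.3 (p. 130).
* [MilneAV2008] J. S. Milne, *Abelian Varieties* (2008), I §8 pp. 36–37 (the dual is unique up to unique isomorphism).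
* [MumfordAV1970] D. Mumford, *Abelian Varieties* (1970), §15 Thm. 1 (p. 143) (`f ↦ f^∨`).
* [GortzWedhorn2020] U. Görtz, T. Wedhorn, *Algebraic Geometry I*, 2nd ed. (2020), Section (4.7) (pp. 107–108).
-/

set_option autoImplicit false

noncomputable section

-- Mathlib's `Over`/pull-back API is stated across semireducible wrappers (as in the ★ `AbelianSchemes/*` files).
set_option backward.isDefEq.respectTransparency false

universe u

open CategoryTheory CategoryTheory.Limits AlgebraicGeometry MonoidalCategory
open scoped MonObj

namespace Literature.AlgebraicGeometry.AbelianSchemes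

namespace AbelianSchemeOver

/-! ### §1 The converse of Layer A: the five clauses along `𝟙 T` come from an isomorphism of group schemes -/

section Converse

variable {T : Scheme.{u}} {A₁ A₂ : AbelianSchemeOver T}

/-- **The `X`-clause along `𝟙 T` makes `G` an isomorphism**: a cartesian square over `𝟙 T` has an invertible top arrow
(Mathlib `IsPullback.isIso_fst_of_isIso`). [cite: MumfordFogartyKirwan1994, Ch. 7 §2 Definition 7.3 (p. 130)] -/
theorem isIso_of_isBaseChangeVia_id {G : A₁.X.left ⟶ A₂.X.left} (h : A₁.IsBaseChangeVia A₂ (𝟙 T) G) : IsIso G := by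
  obtain ⟨-, hpb, -, -⟩ := h
  exact hpb.isIso_fst_of_isIso

/-- `G` lies over `T` (the `X`-clause along `𝟙 T`). [cite: MumfordFogartyKirwan1994, Ch. 7 §2 Definition 7.3 (p. 130)] -/
theorem comp_hom_eq_of_isBaseChangeVia_id {G : A₁.X.left ⟶ A₂.X.left} (h : A₁.IsBaseChangeVia A₂ (𝟙 T) G) :
    G ≫ A₂.X.hom = A₁.X.hom := by
  obtain ⟨w, -⟩ := h
  rw [w, Category.comp_id]

variable [IsReduced T] [IsLocallyNoetherian T]
  (D₁ : A₁.DualPair) (D₂ : A₂.DualPair)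
  (lam₁ : A₁.X ⟶ D₁.hat.X) (lam₂ : A₂.X ⟶ D₂.hat.X)
  (hD₂ : Nonempty ((Scheme.Modules.pullback (DualPair.unitHatSlice D₂)).obj D₂.P ≅ SheafOfModules.unit _))
  {g n : ℕ} (φ₁ : A₁.LevelStructure g n) (φ₂ : A₂.LevelStructure g n)
  {O : Type*} (act₁ : O → (A₁.X ⟶ A₁.X)) (act₂ : O → (A₂.X ⟶ A₂.X))

include hD₂ in
/-- **THE CONVERSE OF LAYER A — an isomorphism of MFK triples along `𝟙 T` IS an isomorphism of group schemes exact on `λ`,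
level and action.**  Over a reduced locally Noetherian `T`, let `(G, Ĝ)` satisfy the five clauses of [MumfordFogartyKirwan1994]
Def. 7.2–7.3 along `𝟙 T` between the tuples `(A₁, λ₁, (Â₁, 𝒫₁), φ₁, ι₁)` and `(A₂, λ₂, (Â₂, 𝒫₂), φ₂, ι₂)` (level ∕ `X`, `X̂`,
Poincaré `(G × Ĝ)^*𝒫₂ ≅ 𝒫₁`, `λ₁ ≫ Ĝ = G ≫ λ₂`, `ι₁(a) ≫ G = G ≫ ι₂(a)`), with `𝒫₂|_{A₂ × {ε}} ≅ 𝒪` (automatic for polarised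
`A₂`, ★ `Polarization.nonempty_unitHatSlice_iso`).  Then `G` underlies an isomorphism of `T`-group schemes `e : A₁ ≅ A₂`
(`IsMonHom e.hom`, ★ `isMonHom_of_isBaseChangeVia_id`), `Ĝ` IS the dual transport `Ĥ_e` ([MilneAV2008] I §8 «unique», ★
`eq_hatTransport_of_nonempty_pullback_map_iso`), the polarisations correspond EXACTLY `e ≫ λ₂ ≫ e^∨ = λ₁` (from `λ₁ ≫ Ĥ_e = e ≫ λ₂`
and ★ `Ĥ_e ≫ e^∨ = 𝟙`), and `e` carries level sections and action.  This is the input of ★ Layer A `isoOfTriples_id_of_iso`.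
[cite: MumfordFogartyKirwan1994, Ch. 7 §2 Definition 7.2 (p. 129) and Definition 7.3 (p. 130)] [cite: MilneAV2008, I §8 pp. 36–37] -/
theorem exists_iso_of_tupleRel_id {G : A₁.X.left ⟶ A₂.X.left} {Ĝ : D₁.hat.X.left ⟶ D₂.hat.X.left}
    (h : φ₁.IsBaseChangeVia φ₂ (𝟙 T) G ∧ D₁.hat.IsBaseChangeVia D₂.hat (𝟙 T) Ĝ ∧
      (∃ (wG : A₁.X.hom ≫ 𝟙 T = G ≫ A₂.X.hom) (wĜ : D₁.hat.X.hom ≫ 𝟙 T = Ĝ ≫ D₂.hat.X.hom),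
        Nonempty ((Scheme.Modules.pullback
          (pullback.map A₁.X.hom D₁.hat.X.hom A₂.X.hom D₂.hat.X.hom G Ĝ (𝟙 T) wG wĜ)).obj D₂.P ≅ D₁.P)) ∧
      lam₁.left ≫ Ĝ = G ≫ lam₂.left ∧ ∀ a : O, (act₁ a).left ≫ G = G ≫ (act₂ a).left) :
    ∃ (e : A₁.X ≅ A₂.X) (_ : IsMonHom e.hom), e.hom.left = G ∧ Ĝ = DualPair.hatTransport D₂ D₁ e ∧
      e.hom ≫ lam₂ ≫ DualPair.dualIsogenyOver e.hom D₁ D₂ = lam₁ ∧ (∀ i, φ₁.σ i ≫ e.hom = φ₂.σ i) ∧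
      ∀ a : O, act₁ a ≫ e.hom = e.hom ≫ act₂ a := by
  obtain ⟨⟨hX, hσ⟩, -, ⟨wG, wĜ, hP⟩, hlam, hact⟩ := h
  haveI : IsIso G := isIso_of_isBaseChangeVia_id hX
  let e : A₁.X ≅ A₂.X := Over.isoMk (asIso G) (comp_hom_eq_of_isBaseChangeVia_id hX)
  have he : e.hom.left = G := rfl
  haveI hmon : IsMonHom e.hom := isMonHom_of_isBaseChangeVia_id e.hom hX
  have hĜ : Ĝ = DualPair.hatTransport D₂ D₁ e := DualPair.eq_hatTransport_of_nonempty_pullback_map_iso D₂ D₁ e Ĝ wG wĜ hP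
  refine ⟨e, hmon, he, hĜ, ?_, fun i => ?_, fun a => ?_⟩
  · -- `λ₁ ≫ Ĥ_e = e ≫ λ₂` in `Over T`, then compose with `e^∨` and use `Ĥ_e ≫ e^∨ = 𝟙`
    have h4 : lam₁ ≫ DualPair.hatTransportOver D₂ D₁ e = e.hom ≫ lam₂ := by
      ext
      rw [Over.comp_left, Over.comp_left, DualPair.hatTransportOver_left, ← hĜ]
      exact hlam
    calc e.hom ≫ lam₂ ≫ DualPair.dualIsogenyOver e.hom D₁ D₂
        = (lam₁ ≫ DualPair.hatTransportOver D₂ D₁ e) ≫ DualPair.dualIsogenyOver e.hom D₁ D₂ := by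
          rw [h4, Category.assoc]
      _ = lam₁ := by
          rw [Category.assoc, DualPair.hatTransportOver_comp_dualIsogenyOver_hom D₂ D₁ e hD₂, Category.comp_id]
  · ext
    rw [Over.comp_left]
    change (φ₁.σ i).left ≫ G = _
    rw [hσ i, Category.id_comp]
  · ext
    rw [Over.comp_left, Over.comp_left]
    exact hact a

include hD₂ in
/-- **ISOMORPHISM OF TRIPLES ALONG `𝟙 T` ⟺ ISOMORPHISM OF GROUP SCHEMES EXACT ON `λ`, LEVEL, ACTION** (★ Layer A
`isoOfTriples_id_of_iso` and its converse `exists_iso_of_tupleRel_id`, packaged; over a reduced connected locally Noetherian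
`T`, both Poincaré sheaves normalised along `Aᵢ × {ε}`).  The dual-side morphism is then NECESSARILY the dual transport `Ĥ_e`.
[cite: MumfordFogartyKirwan1994, Ch. 7 §2 Definition 7.2 (p. 129) and Definition 7.3 (p. 130)] [cite: MilneAV2008, I §8 pp. 36–37] -/
theorem exists_tupleRel_id_iff_exists_iso [PreconnectedSpace T] [IsMonHom lam₂]
    (hD₁ : Nonempty ((Scheme.Modules.pullback (DualPair.unitHatSlice D₁)).obj D₁.P ≅ SheafOfModules.unit _)) :
    (∃ (G : A₁.X.left ⟶ A₂.X.left) (Ĝ : D₁.hat.X.left ⟶ D₂.hat.X.left),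
      φ₁.IsBaseChangeVia φ₂ (𝟙 T) G ∧ D₁.hat.IsBaseChangeVia D₂.hat (𝟙 T) Ĝ ∧
      (∃ (wG : A₁.X.hom ≫ 𝟙 T = G ≫ A₂.X.hom) (wĜ : D₁.hat.X.hom ≫ 𝟙 T = Ĝ ≫ D₂.hat.X.hom),
        Nonempty ((Scheme.Modules.pullback
          (pullback.map A₁.X.hom D₁.hat.X.hom A₂.X.hom D₂.hat.X.hom G Ĝ (𝟙 T) wG wĜ)).obj D₂.P ≅ D₁.P)) ∧
      lam₁.left ≫ Ĝ = G ≫ lam₂.left ∧ ∀ a : O, (act₁ a).left ≫ G = G ≫ (act₂ a).left) ↔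
    ∃ (e : A₁.X ≅ A₂.X) (_ : IsMonHom e.hom),
      e.hom ≫ lam₂ ≫ DualPair.dualIsogenyOver e.hom D₁ D₂ = lam₁ ∧ (∀ i, φ₁.σ i ≫ e.hom = φ₂.σ i) ∧
      ∀ a : O, act₁ a ≫ e.hom = e.hom ≫ act₂ a := by
  constructor
  · rintro ⟨G, Ĝ, h⟩
    obtain ⟨e, he, -, -, hlam, hσ, hact⟩ := exists_iso_of_tupleRel_id D₁ D₂ lam₁ lam₂ hD₂ φ₁ φ₂ act₁ act₂ h
    exact ⟨e, he, hlam, hσ, hact⟩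
  · rintro ⟨e, he, hlam, hσ, hact⟩
    exact ⟨_, _, isoOfTriples_id_of_iso D₁ D₂ lam₁ lam₂ hD₁ hD₂ φ₁ φ₂ act₁ act₂ e hlam hσ hact⟩

end Converse

/-! ### §2 Two tuples: a fibre isomorphism of the ITERATED pull-backs of two tuples, exact on `λ` ∕ level ∕ action, is an
isomorphism of triples between the SINGLE pull-backs (★ `exists_tupleRel_baseChange_comp_of_iso` is the case of one tuple at two points) -/

section TwoTuples

variable {Y Y₀ T : Scheme.{u}} [IsReduced T] [IsLocallyNoetherian T] [PreconnectedSpace T]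
  (𝒜₁ 𝒜₂ : AbelianSchemeOver Y) {O : Type*} [CommRing O] (ρ₁ : RingAction O 𝒜₁) (ρ₂ : RingAction O 𝒜₂)
  (D₁ : 𝒜₁.DualPair) (D₂ : 𝒜₂.DualPair) (pol₁ : 𝒜₁.Polarization D₁) (pol₂ : 𝒜₂.Polarization D₂)
  {g N : ℕ} (lvl₁ : 𝒜₁.LevelStructure g N) (lvl₂ : 𝒜₂.LevelStructure g N) (π : Y₀ ⟶ Y) (x : T ⟶ Y₀)

/-- **TWO-TUPLE «TUPLE-ISO OF FIBRE ISO».**  Let `(𝒜ᵢ, ιᵢ, (Âᵢ, 𝒫ᵢ), λᵢ, lvlᵢ)` (`i = 1, 2`) be two tuples over `Y`,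
`π : Y₀ → Y`, and `x : T → Y₀` a point of a reduced connected locally Noetherian `T` (e.g. `T = Spec Ω`).  An isomorphism of
`T`-group schemes `ε : (𝒜₁ ×_Y Y₀) ×_{Y₀} T ≅ (𝒜₂ ×_Y Y₀) ×_{Y₀} T` of the ITERATED pull-backs which is (pol) EXACT on the
polarisations in dual-homomorphism form `ε ≫ λ₂ ≫ ε^∨ = λ₁`, (lvl) carries the level sections and (act) commutes with the
`𝒪`-actions yields an ISOMORPHISM OF MFK TRIPLES ALONG `𝟙 T` between the SINGLE pull-backs `𝒜₁ ×_{Y, x ≫ π} T` and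
`𝒜₂ ×_{Y, x ≫ π} T` with `𝒪`-equivariance (the five clauses: level ∕ `X`, `X̂`, Poincaré, `λ`, `ι`).  Proof: the comparison
relation of `𝒜₁` at `x` (★ `tupleRel_baseChangeCompGrpIso_hom`), ★ Layer A for `ε`, the inverse comparison of `𝒜₂` (★
`tupleRel_baseChangeCompGrpIso_inv`), composed along `𝟙 T` (★ `tupleRel_comp_id_id`).
[cite: MumfordFogartyKirwan1994, Ch. 7 §2 Definition 7.2 (p. 129) and Definition 7.3 (p. 130)]
[cite: GortzWedhorn2020, Section (4.7) (pp. 107–108)] [cite: MilneAV2008, I §8 pp. 36–37] -/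
theorem exists_tupleRel_baseChange_comp_of_iso₂
    (ε : ((𝒜₁.baseChange π).baseChange x).X ≅ ((𝒜₂.baseChange π).baseChange x).X) [IsMonHom ε.hom]
    (hlam : ε.hom ≫ ((pol₂.baseChange π).baseChange x).lam ≫
        DualPair.dualIsogenyOver ε.hom ((D₁.baseChange π).baseChange x) ((D₂.baseChange π).baseChange x) =
      ((pol₁.baseChange π).baseChange x).lam)
    (hσ : ∀ i, ((lvl₁.baseChange π).baseChange x).σ i ≫ ε.hom = ((lvl₂.baseChange π).baseChange x).σ i)
    (hact : ∀ a, baseChangeHom (baseChangeHom (ρ₁.i a) π) x ≫ ε.hom = ε.hom ≫ baseChangeHom (baseChangeHom (ρ₂.i a) π) x) :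
    ∃ (G : (𝒜₁.baseChange (x ≫ π)).X.left ⟶ (𝒜₂.baseChange (x ≫ π)).X.left)
      (Ĝ : (D₁.baseChange (x ≫ π)).hat.X.left ⟶ (D₂.baseChange (x ≫ π)).hat.X.left),
      (lvl₁.baseChange (x ≫ π)).IsBaseChangeVia (lvl₂.baseChange (x ≫ π)) (𝟙 T) G ∧
      (D₁.baseChange (x ≫ π)).hat.IsBaseChangeVia (D₂.baseChange (x ≫ π)).hat (𝟙 T) Ĝ ∧
      (∃ (wG : (𝒜₁.baseChange (x ≫ π)).X.hom ≫ 𝟙 T = G ≫ (𝒜₂.baseChange (x ≫ π)).X.hom)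
          (wĜ : (D₁.baseChange (x ≫ π)).hat.X.hom ≫ 𝟙 T = Ĝ ≫ (D₂.baseChange (x ≫ π)).hat.X.hom),
        Nonempty ((Scheme.Modules.pullback
          (pullback.map (𝒜₁.baseChange (x ≫ π)).X.hom (D₁.baseChange (x ≫ π)).hat.X.hom
            (𝒜₂.baseChange (x ≫ π)).X.hom (D₂.baseChange (x ≫ π)).hat.X.hom G Ĝ (𝟙 T) wG wĜ)).obj (D₂.baseChange (x ≫ π)).P ≅
          (D₁.baseChange (x ≫ π)).P)) ∧
      (pol₁.baseChange (x ≫ π)).lam.left ≫ Ĝ = G ≫ (pol₂.baseChange (x ≫ π)).lam.left ∧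
      ∀ a : O, (baseChangeHom (ρ₁.i a) (x ≫ π)).left ≫ G = G ≫ (baseChangeHom (ρ₂.i a) (x ≫ π)).left := by
  haveI := ((pol₂.baseChange π).baseChange x).isMonHom
  have r₁ := tupleRel_baseChangeCompGrpIso_hom 𝒜₁ ρ₁ D₁ pol₁ lvl₁ π x
  have r₂ := isoOfTriples_id_of_iso ((D₁.baseChange π).baseChange x) ((D₂.baseChange π).baseChange x)
    ((pol₁.baseChange π).baseChange x).lam ((pol₂.baseChange π).baseChange x).lam
    ((pol₁.baseChange π).baseChange x).nonempty_unitHatSlice_iso ((pol₂.baseChange π).baseChange x).nonempty_unitHatSlice_iso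
    ((lvl₁.baseChange π).baseChange x) ((lvl₂.baseChange π).baseChange x)
    (fun a => baseChangeHom (baseChangeHom (ρ₁.i a) π) x) (fun a => baseChangeHom (baseChangeHom (ρ₂.i a) π) x)
    ε hlam hσ hact
  have r₃ := tupleRel_baseChangeCompGrpIso_inv 𝒜₂ ρ₂ D₂ pol₂ lvl₂ π x
  exact ⟨_, _, tupleRel_comp_id_id (tupleRel_comp_id_id r₁ r₂) r₃⟩

omit [PreconnectedSpace T] in
/-- **The same with the single pull-backs pushed back to the iterated ones** is not needed downstream; instead, the CONVERSE
direction at a point: from the five clauses between the SINGLE pull-backs along `x ≫ π` to an isomorphism of the ITERATED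
pull-backs exact on `λ` ∕ level ∕ action (§1 converse + the comparison relations ★ `tupleRel_baseChangeCompGrpIso_inv ∕ _hom`
on the outside, composed along `𝟙 T`, then §1 again on the iterated tuples).
[cite: MumfordFogartyKirwan1994, Ch. 7 §2 Definition 7.2 (p. 129) and Definition 7.3 (p. 130)]
[cite: GortzWedhorn2020, Section (4.7) (pp. 107–108)] -/
theorem exists_iso₂_of_tupleRel_baseChange_comp
    {G : (𝒜₁.baseChange (x ≫ π)).X.left ⟶ (𝒜₂.baseChange (x ≫ π)).X.left}
    {Ĝ : (D₁.baseChange (x ≫ π)).hat.X.left ⟶ (D₂.baseChange (x ≫ π)).hat.X.left}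
    (h : (lvl₁.baseChange (x ≫ π)).IsBaseChangeVia (lvl₂.baseChange (x ≫ π)) (𝟙 T) G ∧
      (D₁.baseChange (x ≫ π)).hat.IsBaseChangeVia (D₂.baseChange (x ≫ π)).hat (𝟙 T) Ĝ ∧
      (∃ (wG : (𝒜₁.baseChange (x ≫ π)).X.hom ≫ 𝟙 T = G ≫ (𝒜₂.baseChange (x ≫ π)).X.hom)
          (wĜ : (D₁.baseChange (x ≫ π)).hat.X.hom ≫ 𝟙 T = Ĝ ≫ (D₂.baseChange (x ≫ π)).hat.X.hom),
        Nonempty ((Scheme.Modules.pullback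
          (pullback.map (𝒜₁.baseChange (x ≫ π)).X.hom (D₁.baseChange (x ≫ π)).hat.X.hom
            (𝒜₂.baseChange (x ≫ π)).X.hom (D₂.baseChange (x ≫ π)).hat.X.hom G Ĝ (𝟙 T) wG wĜ)).obj (D₂.baseChange (x ≫ π)).P ≅
          (D₁.baseChange (x ≫ π)).P)) ∧
      (pol₁.baseChange (x ≫ π)).lam.left ≫ Ĝ = G ≫ (pol₂.baseChange (x ≫ π)).lam.left ∧
      ∀ a : O, (baseChangeHom (ρ₁.i a) (x ≫ π)).left ≫ G = G ≫ (baseChangeHom (ρ₂.i a) (x ≫ π)).left) :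
    ∃ (ε : ((𝒜₁.baseChange π).baseChange x).X ≅ ((𝒜₂.baseChange π).baseChange x).X) (_ : IsMonHom ε.hom),
      ε.hom.left = (𝒜₁.baseChangeCompGrpIso π x).inv.hom.hom.left ≫ G ≫ (𝒜₂.baseChangeCompGrpIso π x).hom.hom.hom.left ∧
      ε.hom ≫ ((pol₂.baseChange π).baseChange x).lam ≫
          DualPair.dualIsogenyOver ε.hom ((D₁.baseChange π).baseChange x) ((D₂.baseChange π).baseChange x) =
        ((pol₁.baseChange π).baseChange x).lam ∧
      (∀ i, ((lvl₁.baseChange π).baseChange x).σ i ≫ ε.hom = ((lvl₂.baseChange π).baseChange x).σ i) ∧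
      ∀ a, baseChangeHom (baseChangeHom (ρ₁.i a) π) x ≫ ε.hom = ε.hom ≫ baseChangeHom (baseChangeHom (ρ₂.i a) π) x := by
  have r₁ := tupleRel_baseChangeCompGrpIso_inv 𝒜₁ ρ₁ D₁ pol₁ lvl₁ π x
  have r₃ := tupleRel_baseChangeCompGrpIso_hom 𝒜₂ ρ₂ D₂ pol₂ lvl₂ π x
  have r := tupleRel_comp_id_id (tupleRel_comp_id_id r₁ h) r₃
  obtain ⟨ε, hε, hleft, -, hlam, hσ, hact⟩ := exists_iso_of_tupleRel_id ((D₁.baseChange π).baseChange x)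
    ((D₂.baseChange π).baseChange x) ((pol₁.baseChange π).baseChange x).lam ((pol₂.baseChange π).baseChange x).lam
    ((pol₂.baseChange π).baseChange x).nonempty_unitHatSlice_iso ((lvl₁.baseChange π).baseChange x)
    ((lvl₂.baseChange π).baseChange x)
    (fun a => baseChangeHom (baseChangeHom (ρ₁.i a) π) x) (fun a => baseChangeHom (baseChangeHom (ρ₂.i a) π) x) r
  exact ⟨ε, hε, by rw [hleft, Category.assoc], hlam, hσ, hact⟩

end TwoTuples

/-! ### §3 The `λ`-clause under base change to a point: the dual-transport form over the base `B` reads, at `s : T → B`,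
as the dual-homomorphism form for the base-changed isomorphism (★ `eq_hatTransport_baseChange`: the dual transport commutes
with base change) -/

section LamAtPoint

variable {B T : Scheme.{u}} {B₁ B₂ : AbelianSchemeOver B} (D₁ : B₁.DualPair) (D₂ : B₂.DualPair)
  (lam₁ : B₁.X ⟶ D₁.hat.X) (lam₂ : B₂.X ⟶ D₂.hat.X) [IsMonHom lam₂]
  (e : B₁.X ≅ B₂.X) [IsMonHom e.hom] (s : T ⟶ B)
  (ε : (B₁.baseChange s).X ≅ (B₂.baseChange s).X) [IsMonHom ε.hom]

omit [IsMonHom e.hom] [IsMonHom ε.hom] in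
/-- **An isomorphism of the base changes lying over `e` IS the base change of `e`** (both are determined by their two
projections). [cite: GortzWedhorn2020, Section (4.7) (pp. 107–108)] -/
theorem iso_hom_eq_pullback_map_of_lies_over
    (hε : ε.hom.left ≫ pullback.fst B₂.X.hom s = pullback.fst B₁.X.hom s ≫ e.hom.left) :
    ε.hom = (Over.pullback s).map e.hom := by
  have h1 : ((Over.pullback s).map e.hom).left ≫ pullback.fst B₂.X.hom s = pullback.fst B₁.X.hom s ≫ e.hom.left := by
    simp only [Over.pullback_map_left]
    erw [pullback.lift_fst]
  ext
  apply pullback.hom_ext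
  · exact hε.trans h1.symm
  · exact (Over.w ε.hom).trans (Over.w ((Over.pullback s).map e.hom)).symm

omit [IsMonHom lam₂] [IsMonHom ε.hom] in
/-- **The base change of `λ₁ ≫ Ĥ_e = e ≫ λ₂` along `s` is `λ₁' ≫ Ĥ_ε = ε ≫ λ₂'`** for any isomorphism `ε` of the base-changed
group schemes lying over `e` — because the base change of the dual transport `Ĥ_e` IS the dual transport `Ĥ_ε` (★
`eq_hatTransport_baseChange`, [MumfordFogartyKirwan1994] Cor. 6.8: the dual commutes with base change).
[cite: MumfordFogartyKirwan1994, Ch. 6 §1 Cor. 6.8 (p. 118) and Ch. 7 §2 Definition 7.3 (p. 130)] [cite: MilneAV2008, I §8 pp. 36–37] -/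
theorem pullback_map_lam_comp_hatTransportOver_eq_iff [IsMonHom ε.hom]
    (hε : ε.hom.left ≫ pullback.fst B₂.X.hom s = pullback.fst B₁.X.hom s ≫ e.hom.left) :
    (Over.pullback s).map (lam₁ ≫ DualPair.hatTransportOver D₂ D₁ e) = (Over.pullback s).map (e.hom ≫ lam₂) ↔
      baseChangeHom lam₁ s ≫ DualPair.hatTransportOver (D₂.baseChange s) (D₁.baseChange s) ε =
        ε.hom ≫ baseChangeHom lam₂ s := by
  -- the base change of `Ĥ_e` is `Ĥ_ε`
  have hH : (Over.pullback s).map (DualPair.hatTransportOver D₂ D₁ e) =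
      DualPair.hatTransportOver (D₂.baseChange s) (D₁.baseChange s) ε := by
    have hH1 : ((Over.pullback s).map (DualPair.hatTransportOver D₂ D₁ e)).left ≫ pullback.fst D₂.hat.X.hom s =
        pullback.fst D₁.hat.X.hom s ≫ DualPair.hatTransport D₂ D₁ e := by
      simp only [Over.pullback_map_left]
      erw [pullback.lift_fst]
      rfl
    ext
    exact DualPair.eq_hatTransport_baseChange s D₂ D₁ e ε hε _ hH1 (Over.w _)
  rw [Functor.map_comp, Functor.map_comp, hH, ← iso_hom_eq_pullback_map_of_lies_over e s ε hε]

/-- **THE `λ`-CLAUSE AT A POINT.**  Let `e : B₁ ≅ B₂` be an isomorphism of abelian schemes over `B` (as group schemes), `λᵢ`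
homomorphisms to duals `(B̂ᵢ, 𝒫ᵢ)` with `𝒫₂|_{B₂ × {ε}} ≅ 𝒪`, `s : T → B` with `T` reduced locally Noetherian (e.g. a geometric
point), and `ε` an isomorphism of the base-changed group schemes lying over `e`.  Then the dual-transport clause
`λ₁ ≫ Ĥ_e = e ≫ λ₂` holds AFTER BASE CHANGE ALONG `s` iff the polarisations of the base-changed tuples correspond EXACTLY under
`ε`: `ε ≫ λ₂' ≫ ε^∨ = λ₁'` — the `hlam` input of ★ Layer A at `T`.  (The unit hypothesis passes to `T` by ★
`nonempty_unitHatSlice_baseChange_iso`; `Ĥ_ε ≫ ε^∨ = 𝟙` by ★ `hatTransportOver_comp_dualIsogenyOver_hom`.)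
[cite: MumfordFogartyKirwan1994, Ch. 6 §1 Cor. 6.8 (p. 118) and Ch. 7 §2 Definition 7.3 (p. 130)] [cite: MumfordAV1970, §15 Thm. 1 (p. 143)] -/
theorem pullback_map_lam_comp_hatTransportOver_eq_iff_comp_dualIsogenyOver_eq [IsReduced T] [IsLocallyNoetherian T]
    (hD₂ : Nonempty ((Scheme.Modules.pullback (DualPair.unitHatSlice D₂)).obj D₂.P ≅ SheafOfModules.unit _))
    (hε : ε.hom.left ≫ pullback.fst B₂.X.hom s = pullback.fst B₁.X.hom s ≫ e.hom.left) :
    (Over.pullback s).map (lam₁ ≫ DualPair.hatTransportOver D₂ D₁ e) = (Over.pullback s).map (e.hom ≫ lam₂) ↔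
      ε.hom ≫ baseChangeHom lam₂ s ≫ DualPair.dualIsogenyOver ε.hom (D₁.baseChange s) (D₂.baseChange s) =
        baseChangeHom lam₁ s := by
  have hD₂' := DualPair.nonempty_unitHatSlice_baseChange_iso (g := s) D₂ hD₂
  haveI : IsMonHom (baseChangeHom lam₂ s) := isMonHom_baseChangeHom lam₂ s
  rw [pullback_map_lam_comp_hatTransportOver_eq_iff D₁ D₂ lam₁ lam₂ e s ε hε]
  constructor
  · intro h
    calc ε.hom ≫ baseChangeHom lam₂ s ≫ DualPair.dualIsogenyOver ε.hom (D₁.baseChange s) (D₂.baseChange s)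
        = (baseChangeHom lam₁ s ≫ DualPair.hatTransportOver (D₂.baseChange s) (D₁.baseChange s) ε) ≫
            DualPair.dualIsogenyOver ε.hom (D₁.baseChange s) (D₂.baseChange s) := by rw [h, Category.assoc]
      _ = baseChangeHom lam₁ s := by
          rw [Category.assoc]
          erw [DualPair.hatTransportOver_comp_dualIsogenyOver_hom _ _ ε hD₂', Category.comp_id]
  · intro h
    ext
    rw [Over.comp_left, Over.comp_left, DualPair.hatTransportOver_left]
    exact DualPair.lam_left_comp_hatTransport_of_comp_dualIsogenyOver_eq _ _ ε hD₂' _ _ h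

end LamAtPoint

/-! ### §4 (ED. 2) The explicit `G` of the two-tuple transfer, and its CLASSIFICATION in Hom-scheme currency

For the consumer `stub_ICON` the isomorphism of triples produced by `exists_tupleRel_baseChange_comp_of_iso₂` must be a KNOWN
morphism (its graph letters are read through the Hom-scheme piece classifying it): it is `G := E₁ ≫ ε ≫ E₂⁻¹` with
`Eᵢ := 𝒜ᵢ.baseChangeCompGrpIso π x`; and if `ε = U ×_{Y₀} T` for a `Y₀`-morphism `U : 𝒜₁ ×_Y Y₀ → 𝒜₂ ×_Y Y₀` classified by
`w : Y₀ → M` with respect to a Hom-scheme datum `(M, m, u)` (★ `Morphisms/HomSchemeYoneda` comparison currency), then `G` is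
classified by `x ≫ w`. -/

section ExplicitG

variable {Y Y₀ T : Scheme.{u}} [IsReduced T] [IsLocallyNoetherian T] [PreconnectedSpace T]
  (𝒜₁ 𝒜₂ : AbelianSchemeOver Y) {O : Type*} [CommRing O] (ρ₁ : RingAction O 𝒜₁) (ρ₂ : RingAction O 𝒜₂)
  (D₁ : 𝒜₁.DualPair) (D₂ : 𝒜₂.DualPair) (pol₁ : 𝒜₁.Polarization D₁) (pol₂ : 𝒜₂.Polarization D₂)
  {g N : ℕ} (lvl₁ : 𝒜₁.LevelStructure g N) (lvl₂ : 𝒜₂.LevelStructure g N) (π : Y₀ ⟶ Y) (x : T ⟶ Y₀)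

/-- **TWO-TUPLE «TUPLE-ISO OF FIBRE ISO» WITH THE EXPLICIT `G = E₁ ≫ ε ≫ E₂⁻¹`** (same statement and proof as
`exists_tupleRel_baseChange_comp_of_iso₂`, the `X`-morphism of the conclusion displayed: `Eᵢ := 𝒜ᵢ.baseChangeCompGrpIso π x`).
[cite: MumfordFogartyKirwan1994, Ch. 7 §2 Definition 7.2 (p. 129) and Definition 7.3 (p. 130)]
[cite: GortzWedhorn2020, Section (4.7) (pp. 107–108)] -/
theorem exists_tupleRel_baseChange_comp_of_iso₂_explicit
    (ε : ((𝒜₁.baseChange π).baseChange x).X ≅ ((𝒜₂.baseChange π).baseChange x).X) [IsMonHom ε.hom]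
    (hlam : ε.hom ≫ ((pol₂.baseChange π).baseChange x).lam ≫
        DualPair.dualIsogenyOver ε.hom ((D₁.baseChange π).baseChange x) ((D₂.baseChange π).baseChange x) =
      ((pol₁.baseChange π).baseChange x).lam)
    (hσ : ∀ i, ((lvl₁.baseChange π).baseChange x).σ i ≫ ε.hom = ((lvl₂.baseChange π).baseChange x).σ i)
    (hact : ∀ a, baseChangeHom (baseChangeHom (ρ₁.i a) π) x ≫ ε.hom = ε.hom ≫ baseChangeHom (baseChangeHom (ρ₂.i a) π) x) :
    ∃ (Ĝ : (D₁.baseChange (x ≫ π)).hat.X.left ⟶ (D₂.baseChange (x ≫ π)).hat.X.left),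
      (lvl₁.baseChange (x ≫ π)).IsBaseChangeVia (lvl₂.baseChange (x ≫ π)) (𝟙 T)
          (((𝒜₁.baseChangeCompGrpIso π x).hom.hom.hom.left ≫ ε.hom.left) ≫ (𝒜₂.baseChangeCompGrpIso π x).inv.hom.hom.left) ∧
      (D₁.baseChange (x ≫ π)).hat.IsBaseChangeVia (D₂.baseChange (x ≫ π)).hat (𝟙 T) Ĝ ∧
      (∃ (wG : (𝒜₁.baseChange (x ≫ π)).X.hom ≫ 𝟙 T =
            (((𝒜₁.baseChangeCompGrpIso π x).hom.hom.hom.left ≫ ε.hom.left) ≫ (𝒜₂.baseChangeCompGrpIso π x).inv.hom.hom.left) ≫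
              (𝒜₂.baseChange (x ≫ π)).X.hom)
          (wĜ : (D₁.baseChange (x ≫ π)).hat.X.hom ≫ 𝟙 T = Ĝ ≫ (D₂.baseChange (x ≫ π)).hat.X.hom),
        Nonempty ((Scheme.Modules.pullback
          (pullback.map (𝒜₁.baseChange (x ≫ π)).X.hom (D₁.baseChange (x ≫ π)).hat.X.hom
            (𝒜₂.baseChange (x ≫ π)).X.hom (D₂.baseChange (x ≫ π)).hat.X.hom
            (((𝒜₁.baseChangeCompGrpIso π x).hom.hom.hom.left ≫ ε.hom.left) ≫ (𝒜₂.baseChangeCompGrpIso π x).inv.hom.hom.left)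
            Ĝ (𝟙 T) wG wĜ)).obj (D₂.baseChange (x ≫ π)).P ≅
          (D₁.baseChange (x ≫ π)).P)) ∧
      (pol₁.baseChange (x ≫ π)).lam.left ≫ Ĝ =
        (((𝒜₁.baseChangeCompGrpIso π x).hom.hom.hom.left ≫ ε.hom.left) ≫ (𝒜₂.baseChangeCompGrpIso π x).inv.hom.hom.left) ≫
          (pol₂.baseChange (x ≫ π)).lam.left ∧
      ∀ a : O, (baseChangeHom (ρ₁.i a) (x ≫ π)).left ≫
          (((𝒜₁.baseChangeCompGrpIso π x).hom.hom.hom.left ≫ ε.hom.left) ≫ (𝒜₂.baseChangeCompGrpIso π x).inv.hom.hom.left) =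
        (((𝒜₁.baseChangeCompGrpIso π x).hom.hom.hom.left ≫ ε.hom.left) ≫ (𝒜₂.baseChangeCompGrpIso π x).inv.hom.hom.left) ≫
          (baseChangeHom (ρ₂.i a) (x ≫ π)).left := by
  haveI := ((pol₂.baseChange π).baseChange x).isMonHom
  have r₁ := tupleRel_baseChangeCompGrpIso_hom 𝒜₁ ρ₁ D₁ pol₁ lvl₁ π x
  have r₂ := isoOfTriples_id_of_iso ((D₁.baseChange π).baseChange x) ((D₂.baseChange π).baseChange x)
    ((pol₁.baseChange π).baseChange x).lam ((pol₂.baseChange π).baseChange x).lam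
    ((pol₁.baseChange π).baseChange x).nonempty_unitHatSlice_iso ((pol₂.baseChange π).baseChange x).nonempty_unitHatSlice_iso
    ((lvl₁.baseChange π).baseChange x) ((lvl₂.baseChange π).baseChange x)
    (fun a => baseChangeHom (baseChangeHom (ρ₁.i a) π) x) (fun a => baseChangeHom (baseChangeHom (ρ₂.i a) π) x)
    ε hlam hσ hact
  have r₃ := tupleRel_baseChangeCompGrpIso_inv 𝒜₂ ρ₂ D₂ pol₂ lvl₂ π x
  exact ⟨_, tupleRel_comp_id_id (tupleRel_comp_id_id r₁ r₂) r₃⟩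

end ExplicitG

section Classification

section Comparison

variable {Y Y₀ T : Scheme.{u}} (𝒜 : AbelianSchemeOver Y) (π : Y₀ ⟶ Y) (x : T ⟶ Y₀)

/-- The comparison `E⁻¹ : (𝒜 ×_Y Y₀) ×_{Y₀} T → 𝒜 ×_Y T` followed by the comparison map to `𝒜 ×_Y Y₀` along `x` is the first
projection (both agree after the two projections of `𝒜 ×_Y Y₀`). [cite: GortzWedhorn2020, Section (4.7) (pp. 107–108)] -/
theorem baseChangeCompGrpIso_inv_left_comp_map :
    (𝒜.baseChangeCompGrpIso π x).inv.hom.hom.left ≫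
        pullback.map 𝒜.X.hom (x ≫ π) 𝒜.X.hom π (𝟙 _) x (𝟙 Y) (by simp) (by simp) =
      pullback.fst (pullback.snd 𝒜.X.hom π) x := by
  apply pullback.hom_ext
  · rw [Category.assoc, pullback.lift_fst, Category.comp_id, baseChangeCompGrpIso_inv_left_fst]
  · rw [Category.assoc, pullback.lift_snd, baseChangeCompGrpIso_inv_left_snd_assoc, pullback.condition]

/-- The comparison `E : 𝒜 ×_Y T → (𝒜 ×_Y Y₀) ×_{Y₀} T` followed by the first projection is the comparison map to `𝒜 ×_Y Y₀`
along `x`. [cite: GortzWedhorn2020, Section (4.7) (pp. 107–108)] -/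
theorem baseChangeCompGrpIso_hom_left_comp_fst :
    (𝒜.baseChangeCompGrpIso π x).hom.hom.hom.left ≫ pullback.fst (pullback.snd 𝒜.X.hom π) x =
      pullback.map 𝒜.X.hom (x ≫ π) 𝒜.X.hom π (𝟙 _) x (𝟙 Y) (by simp) (by simp) := by
  rw [← baseChangeCompGrpIso_inv_left_comp_map 𝒜 π x, baseChangeCompGrpIso_hom_left_inv_left_assoc]

end Comparison

variable {Y Y₀ T M : Scheme.{u}} (𝒜₁ 𝒜₂ : AbelianSchemeOver Y) (m : M ⟶ Y)
  (u : pullback 𝒜₁.X.hom m ⟶ pullback 𝒜₂.X.hom m) (π : Y₀ ⟶ Y) (w : Y₀ ⟶ M) (hw : w ≫ m = π)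
  (U : (𝒜₁.baseChange π).X ⟶ (𝒜₂.baseChange π).X) (x : T ⟶ Y₀)

/-- **`G = E₁ ≫ (U ×_{Y₀} T) ≫ E₂⁻¹` IS CLASSIFIED BY `x ≫ w` WHENEVER `U` IS CLASSIFIED BY `w`** (Hom-scheme currency of ★
`Morphisms/HomSchemeYoneda`: «`φ` is classified by `w` w.r.t. `(M, m, u)`» means `φ ≫ cmp_w = cmp_w ≫ u` with Mathlib's comparison
maps `pullback.map _ _ _ _ (𝟙 _) w (𝟙 Y)`; ★ `Morphisms.comparison_comp`).  This identifies the `X`-morphism of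
`exists_tupleRel_baseChange_comp_of_iso₂_explicit` with the base change of the universal morphism, so that its graph letters are read on
the piece. [cite: GortzWedhorn2020, Prop. 4.16 (p. 101) and Section (4.7) (pp. 107–108)]
[cite: MumfordFogartyKirwan1994, Ch. 0 §5 (c) (p. 23)] -/
theorem comp_comparison_eq_of_classified
    (hU : U.left ≫ pullback.map 𝒜₂.X.hom π 𝒜₂.X.hom m (𝟙 _) w (𝟙 Y) (by simp) (by simpa using hw.symm) =
      pullback.map 𝒜₁.X.hom π 𝒜₁.X.hom m (𝟙 _) w (𝟙 Y) (by simp) (by simpa using hw.symm) ≫ u) :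
    (((𝒜₁.baseChangeCompGrpIso π x).hom.hom.hom.left ≫ ((Over.pullback x).map U).left) ≫
        (𝒜₂.baseChangeCompGrpIso π x).inv.hom.hom.left) ≫
        pullback.map 𝒜₂.X.hom (x ≫ π) 𝒜₂.X.hom m (𝟙 _) (x ≫ w) (𝟙 Y) (by simp) (by simp [hw]) =
      pullback.map 𝒜₁.X.hom (x ≫ π) 𝒜₁.X.hom m (𝟙 _) (x ≫ w) (𝟙 Y) (by simp) (by simp [hw]) ≫ u := by
  have hU' : ((Over.pullback x).map U).left ≫ pullback.fst (pullback.snd 𝒜₂.X.hom π) x =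
      pullback.fst (pullback.snd 𝒜₁.X.hom π) x ≫ U.left := by
    simp only [Over.pullback_map_left]
    erw [pullback.lift_fst]
    rfl
  have h₂ := baseChangeCompGrpIso_inv_left_comp_map 𝒜₂ π x
  have h₁ := baseChangeCompGrpIso_hom_left_comp_fst 𝒜₁ π x
  rw [Morphisms.comparison_comp 𝒜₂.X.hom (x ≫ π) π m x rfl w hw (x ≫ w) rfl (by simp [hw]),
    Morphisms.comparison_comp 𝒜₁.X.hom (x ≫ π) π m x rfl w hw (x ≫ w) rfl (by simp [hw])]
  simp only [Category.assoc]
  rw [reassoc_of% h₂, reassoc_of% hU', hU, ← reassoc_of% h₁]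

end Classification

end AbelianSchemeOver

end Literature.AlgebraicGeometry.AbelianSchemes

end
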